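/-
b2b-lace packet, CARVER gen 27 (unit `b2b-lace-carver-g27`).  HOME/LEMMAS node D10H-2k-X (child of D10H-2k-T, p215181): the NEAR/FAR
READING of the two near cells `(0,0,𝒳)`, `(1,0,𝒳)` of `f₃` (lean2-g18 `NobleWeightedDiagramBoundSmallX` §3–§5) AT THE ALTERNATIVE TRUE TABLES
`srwTrueAlt d α̲ ᾱ` of `NobleF3TrueTablesAlt`.  Additive: no existing module is modified; d-generic; no numeral; no named fact; no dimension
sentence.
-/
import Literature.Probability.FitznerVanDerHofstad2017.NobleWeightedDiagramBoundSmallX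
import Literature.Probability.FitznerVanDerHofstad2017.NobleF3TrueTablesAlt
import HarnessLib

/-!
# Literature.Probability.FitznerVanDerHofstad2017.NobleWeightedDiagramBoundSmallXAlt — the near cells of `f₃` on the shell, alternative true tables

CITATION HEADER (PLACEMENT v2). Part of a certified REPRODUCTION of R. Fitzner, R. van der Hofstad, *Mean-field behavior for nearest-neighbor
percolation in `d > 10`*, Electron. J. Probab. 22 (2017) no. 43 [FvdH17], (2.21)–(2.23) and §2.5 (the six cells of `f₃`; notebook
`Percolation.nb` `boundF3[2,o]`, `boundF3[3,o]`: the near cells read through the two-point function on the shell `‖x‖₁ = 2` and through the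
table majorant only on `Q = {‖x‖₁ ≥ 3}`), and of *Generalized approach to the non-backtracking lace expansion*, Probab. Theory Related Fields
169 (2017) 1041–1119 [NoBLE17], §3.3.5 (3.61)–(3.64) (Step 1, the table `IM`) and (3.87) p. 1079:

> [NoBLE17] p. 1079, (3.87): "`f₃(z) ≤ max_{{n,l,S} ∈ 𝒮} sup_{x ∈ S} (Σ_{i=1}^5 BoundH[i](n,l,x)) / c_{n,l,S}`";
> [FvdH17] (2.23): the six cells `(n_k, l_k, S_k)` of `f₃`.

Every `[cite:]` tag below is a LOCATOR for comparison, not an appeal to authority: all statements are proved here from tree theorems.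
DIVERGENCE D80 (packet): the Step-1 leaf is used in its PER-KEY ALTERNATIVE form (`NobleH1StepD80`, p214981), every table-side condition
discharged at the alternative true tables `srwTrueAlt` (`NobleF3TrueTablesAlt`, p215181); the shell reading (§1–§2 of
`NobleWeightedDiagramBoundSmallX`) is table-free and is reused verbatim.

## What this module does (HOME/LEMMAS D10H-2k-X)

1. `nobleH_le_boundHD75_srwTrueAlt` — the pointwise majorant `ℋ^{n,l}_p(x) ≤ boundHD75 (srwTrueAlt d α̲_F ᾱ_F) n l x r` (`n ≤ 1`) from an
   admissible witness (twin of `nobleH_le_boundHD75_srwTrue`).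
2. `nobleWeightedDiagramBoundAt_of_witness_srwTrueAlt_smallX`, `…_of_simplifiedFormF3_srwTrueAlt_smallX` — the six cells with the near/far
   reading, table-majorant cells at `srwTrueAlt` (twins of lean2-g18 §4; proofs verbatim with the alternative majorant).
3. `nobleImprovementInputsAt_of_simplifiedFormF3_srwTrueAlt_smallX` — packaged over the window (twin of lean2-g18 §5).

What remains displayed after this module: the table-majorant cells at `srwTrueAlt` on `Q` for `(0,0)`, `(1,0)`, on `𝒳` for `(1,1)`, `(1,2)`,
`(1,3)`, at `0` for `(1,6)` (reduced to node values on `𝒳` by `F3BoundsCellReductionAlt`; the symmetry / cone reduction on `Q` at `srwTrueAlt`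
is NOT in the tree yet), the SRW value `I_{1,4}(0) ≤ V` and the two numeric shell inequalities.

Heartbeat census (packet filing rule): the four declarations are term-mode compositions / a `fin_cases` on six cells copied from lean2-g18;
nothing approaches 100 000; no option set.
-/

noncomputable section

open MeasureTheory Real
open Literature.Barriers.CriticalPhenomena
open Literature.Probability.LatticeModels
open Literature.Probability.Percolation

namespace Literature.Probability.FitznerVanDerHofstad2017

variable {d : ℕ}

/-! ## 1. The pointwise majorant at the alternative true tables -/

open F3Bounds in
/-- **The pointwise majorant at the ALTERNATIVE TRUE tables**: for `d ≥ 9`, `p < p_c`, an admissible witness at well-formed `r` with (H-Γ) at `n ≤ 1` and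
`1 ≤ α̲_F`, `ℋ^{n,l}_p(x) ≤ boundHD75 (srwTrueAlt d α̲_F ᾱ_F) n l x r` for `n ≤ 1` and all `l`, `x` — [NoBLE17] (3.87) pointwise, every table-side
condition (`K`, `U`, (H-T), the per-key alternative `SlotAlt`, (H-IM1), (H-low1)) discharged by `NobleF3TrueTablesAlt` §3.
[cite: FitznerVanDerHofstad2016NoBLE, §3.3.5 (3.58)–(3.59) p. 1074 and (3.60)–(3.87) pp. 1075–1079] [cite: FitznerVanDerHofstad2017, §2.5; notebook General.nb `BoundHn`] -/
theorem nobleH_le_boundHD75_srwTrueAlt (hd : 9 ≤ d) {p : unitInterval} (hp : (p : ℝ) < criticalProb (zdGraph d) (0 : Site d))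
    {B : NobleBeta} {E : NobleBetaF3} {r : F3Bounds.Args}
    (hW : ∃ (cΦ αΦ cF αF : ℝ) (RΦ RF : Site d → ℝ), NobleF3Witness d p B E r cΦ αΦ cF αF RΦ RF)
    (hr : r.WF) (hΓ : ∀ n ≤ 1, r.Gamma2dash ^ n * r.bRp ≤ r.bRpDelta) (hα1 : 1 ≤ r.afmin)
    {n : ℕ} (hn : n ≤ 1) (l : ℕ) (x : Site d) :
    nobleH d n l p x ≤ boundHD75 (srwTrueAlt d r.afmin r.afmax) n l x r :=
  have hd1 : 1 ≤ d := by omega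
  have hα : 0 < r.afmin := lt_of_lt_of_le one_pos hα1
  (le_abs_self _).trans
    (abs_nobleH_le_boundHD75_of_witness (n := n) (by omega) hp hW hr (hΓ n hn) (srwTrueAlt d r.afmin r.afmax)
      (fun _ _ _ => rfl) (fun _ _ _ => rfl) (fun m j y => srwTS_le_srwTrueAlt_T m j y) l x
      (NobleF3Witness.step1_of_alt_tables hd hα1 (srwTrueAlt d r.afmin r.afmax)
        (fun m j y _ => slotAlt_srwTrueAlt hd1 hα m j y) (fun j y => srwI_add_le_srwTrueAlt_IM_negOne j y)
        (fun j y => srwI_two_le_mul_srwTrueAlt_IM_negOne hd1 hα j y) (fun m j y => srwTS_le_srwTrueAlt_T m j y) n hn l x))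

/-! ## 2. The six cells with the near/far reading of `(0,0,𝒳)` and `(1,0,𝒳)`, alternative true tables -/

open F3Bounds in
/-- **(S2b)-IMPR at the ALTERNATIVE true tables, near/far reading of the first two cells.**  For `d ≥ 9`, `p < p_c`, an admissible witness at well-formed `r`
with (H-Γ) at `n ≤ 1`, `1 ≤ α̲_F`, `b_k ≥ 0`: if on the shell `‖x‖₁ = 2` we have `4 τ_p(x) ≤ b₀` and `4 τ_p(x) + 2dp · b₂ ≤ b₁`, on `Q = {‖x‖₁ ≥ 3}` the
table-majorant cells `boundHD75 (srwTrueAlt …) 0 0 x r ≤ b₀`, `boundHD75 (srwTrueAlt …) 1 0 x r ≤ b₁`, and the cells `(1,1)`, `(1,2)`, `(1,3)` on `𝒳`,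
`(1,6)` at `0` as in `nobleWeightedDiagramBoundAt_of_witness_srwTrueAlt`, then `NobleWeightedDiagramBoundAt d p b` ([FvdH17] (2.23): all six
`sup_{x ∈ S_k} ℋ^{n_k,l_k}_p(x) ≤ b_k`).  Shell: `ℋ^{0,0} = ‖x‖₂² τ ≤ 4τ`, `ℋ^{1,0} ≤ ‖x‖₂² τ + 2dp ℋ^{1,1} ≤ 4τ + 2dp b₂` (§1, cell `(1,1)`).
[cite: FitznerVanDerHofstad2017, (2.21)–(2.23), §2.5; notebook Percolation.nb `boundF3[2,o]`, `boundF3[3,o]`]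
[cite: FitznerVanDerHofstad2016NoBLE, §3.3.5 (3.87) p. 1079; §5.1 p. 1093 (the set Q)] -/
theorem nobleWeightedDiagramBoundAt_of_witness_srwTrueAlt_smallX (hd : 9 ≤ d) {p : unitInterval}
    (hp : (p : ℝ) < criticalProb (zdGraph d) (0 : Site d)) {B : NobleBeta} {E : NobleBetaF3} {r : F3Bounds.Args}
    (hW : ∃ (cΦ αΦ cF αF : ℝ) (RΦ RF : Site d → ℝ), NobleF3Witness d p B E r cΦ αΦ cF αF RΦ RF)
    (hr : r.WF) (hΓ : ∀ n ≤ 1, r.Gamma2dash ^ n * r.bRp ≤ r.bRpDelta) (hα1 : 1 ≤ r.afmin)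
    {b : Fin 6 → ℝ} (hb : ∀ k, 0 ≤ b k)
    (hS0 : ∀ x : Site d, ∑ j, |x j| = 2 → 4 * tau d p 0 x ≤ b 0)
    (hS1 : ∀ x : Site d, ∑ j, |x j| = 2 → 4 * tau d p 0 x + 2 * d * (p : ℝ) * b 2 ≤ b 1)
    (h0Q : ∀ x : Site d, 3 ≤ ∑ j, |x j| → boundHD75 (srwTrueAlt d r.afmin r.afmax) 0 0 x r ≤ b 0)
    (h1Q : ∀ x : Site d, 3 ≤ ∑ j, |x j| → boundHD75 (srwTrueAlt d r.afmin r.afmax) 1 0 x r ≤ b 1)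
    (h2 : ∀ x ∈ calX d, boundHD75 (srwTrueAlt d r.afmin r.afmax) 1 1 x r ≤ b 2)
    (h3 : ∀ x ∈ calX d, boundHD75 (srwTrueAlt d r.afmin r.afmax) 1 2 x r ≤ b 3)
    (h4 : ∀ x ∈ calX d, boundHD75 (srwTrueAlt d r.afmin r.afmax) 1 3 x r ≤ b 4)
    (h5 : boundHD75 (srwTrueAlt d r.afmin r.afmax) 1 6 0 r ≤ b 5) :
    NobleWeightedDiagramBoundAt d p b := by
  have hd2 : 2 ≤ d := by omega
  have h2dp : 0 ≤ 2 * d * (p : ℝ) := by have := p.2.1; positivity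
  have hle : ∀ {n : ℕ}, n ≤ 1 → ∀ (l : ℕ) (x : Site d), nobleH d n l p x ≤ boundHD75 (srwTrueAlt d r.afmin r.afmax) n l x r :=
    fun {n} hn l x => nobleH_le_boundHD75_srwTrueAlt hd hp hW hr hΓ hα1 hn l x
  have hz : (0 : ℕ) ≤ 1 := Nat.zero_le 1
  have h4τ : ∀ x : Site d, ∑ j, |x j| = 2 → euclidNorm x ^ 2 * tau d p 0 x ≤ 4 * tau d p 0 x := fun x hx =>
    mul_le_mul_of_nonneg_right (euclidNorm_sq_le_four_of_sum_abs_eq_two hx) (tau_nonneg p 0 x)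
  refine nobleWeightedDiagramBoundAt_of_forall hb fun k => ?_
  fin_cases k
  · show ∀ x ∈ calX d, nobleH d 0 0 p x ≤ b 0
    refine forall_mem_calX_iff_shell_and_Q.2 ⟨fun x hx => ?_, fun x hx => (hle hz 0 x).trans (h0Q x hx)⟩
    rw [nobleH_zero_zero_eq]
    exact (h4τ x hx).trans (hS0 x hx)
  · show ∀ x ∈ calX d, nobleH d 1 0 p x ≤ b 1
    refine forall_mem_calX_iff_shell_and_Q.2 ⟨fun x hx => ?_, fun x hx => (hle le_rfl 0 x).trans (h1Q x hx)⟩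
    have h11x : nobleH d 1 1 p x ≤ b 2 := (hle le_rfl 1 x).trans (h2 x (mem_calX_of_two_le_sum_abs x hx.ge))
    calc nobleH d 1 0 p x ≤ euclidNorm x ^ 2 * tau d p 0 x + 2 * d * (p : ℝ) * nobleH d 1 1 p x := nobleH_one_zero_le hd2 p hp x
      _ ≤ 4 * tau d p 0 x + 2 * d * (p : ℝ) * b 2 := add_le_add (h4τ x hx) (mul_le_mul_of_nonneg_left h11x h2dp)
      _ ≤ b 1 := hS1 x hx
  · show ∀ x ∈ calX d, nobleH d 1 1 p x ≤ b 2
    exact fun x hx => (hle le_rfl 1 x).trans (h2 x hx)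
  · show ∀ x ∈ calX d, nobleH d 1 2 p x ≤ b 3
    exact fun x hx => (hle le_rfl 2 x).trans (h3 x hx)
  · show ∀ x ∈ calX d, nobleH d 1 3 p x ≤ b 4
    exact fun x hx => (hle le_rfl 3 x).trans (h4 x hx)
  · show ∀ x ∈ ({0} : Set (Site d)), nobleH d 1 6 p x ≤ b 5
    intro x hx
    rw [Set.mem_singleton_iff] at hx
    subst hx
    exact (hle le_rfl 6 0).trans h5

open F3Bounds in
/-- **The same from the extended simplified form** `NobleSimplifiedFormF3At d p B E` below `p_c` under `f₂(p) ≤ Γ₂`, at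
`r = NobleBetaF3.toArgs d B E Γ₂` (`1 ≤ α̲_F = B.αFlow`, `β_Δ < α̲_F`), near/far reading of the first two cells.
[cite: FitznerVanDerHofstad2017, (2.21)–(2.23), §2.5; notebook Percolation.nb `boundF3[2,o]`, `boundF3[3,o]`]
[cite: FitznerVanDerHofstad2016NoBLE, §3.3.5 (3.87) p. 1079; §3.3.4 pp. 1072–1074] -/
theorem nobleWeightedDiagramBoundAt_of_simplifiedFormF3_srwTrueAlt_smallX (hd : 9 ≤ d) {p : unitInterval}
    (hp : (p : ℝ) < criticalProb (zdGraph d) (0 : Site d)) {B : NobleBeta} {E : NobleBetaF3} {Γ₂ : ℝ}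
    (hF3 : NobleSimplifiedFormF3At d p B E) (hΓ2 : nobleF2 d p ≤ Γ₂) (hα1 : 1 ≤ B.αFlow) (hgap : B.βΔ < B.αFlow)
    (hr : (NobleBetaF3.toArgs d B E Γ₂).WF)
    (hΓ : ∀ n ≤ 1, (NobleBetaF3.toArgs d B E Γ₂).Gamma2dash ^ n * (NobleBetaF3.toArgs d B E Γ₂).bRp ≤
      (NobleBetaF3.toArgs d B E Γ₂).bRpDelta)
    {b : Fin 6 → ℝ} (hb : ∀ k, 0 ≤ b k)
    (hS0 : ∀ x : Site d, ∑ j, |x j| = 2 → 4 * tau d p 0 x ≤ b 0)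
    (hS1 : ∀ x : Site d, ∑ j, |x j| = 2 → 4 * tau d p 0 x + 2 * d * (p : ℝ) * b 2 ≤ b 1)
    (h0Q : ∀ x : Site d, 3 ≤ ∑ j, |x j| → boundHD75 (srwTrueAlt d B.αFlow E.αFup) 0 0 x (NobleBetaF3.toArgs d B E Γ₂) ≤ b 0)
    (h1Q : ∀ x : Site d, 3 ≤ ∑ j, |x j| → boundHD75 (srwTrueAlt d B.αFlow E.αFup) 1 0 x (NobleBetaF3.toArgs d B E Γ₂) ≤ b 1)
    (h2 : ∀ x ∈ calX d, boundHD75 (srwTrueAlt d B.αFlow E.αFup) 1 1 x (NobleBetaF3.toArgs d B E Γ₂) ≤ b 2)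
    (h3 : ∀ x ∈ calX d, boundHD75 (srwTrueAlt d B.αFlow E.αFup) 1 2 x (NobleBetaF3.toArgs d B E Γ₂) ≤ b 3)
    (h4 : ∀ x ∈ calX d, boundHD75 (srwTrueAlt d B.αFlow E.αFup) 1 3 x (NobleBetaF3.toArgs d B E Γ₂) ≤ b 4)
    (h5 : boundHD75 (srwTrueAlt d B.αFlow E.αFup) 1 6 0 (NobleBetaF3.toArgs d B E Γ₂) ≤ b 5) :
    NobleWeightedDiagramBoundAt d p b :=
  nobleWeightedDiagramBoundAt_of_witness_srwTrueAlt_smallX hd hp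
    (hF3.exists_witness (by omega) hp hΓ2 (lt_of_lt_of_le one_pos hα1) hgap) hr hΓ hα1 hb hS0 hS1 h0Q h1Q h2 h3 h4 h5

/-! ## 3. Packaging over the window as `NobleImprovementInputsAt`, shell cells in the bootstrap constants -/

open F3Bounds in
/-- **The improvement-step input of the numeric certificate at the ALTERNATIVE true tables, near/far reading of the first two `f₃` cells.**  For `d ≥ 9`:
if at every `p ∈ (p_I, p_c)` with `f_i(p) ≤ Γ_i` the two-point function has the extended simplified form `NobleSimplifiedFormF3At d p B E`,
`1 ≤ α̲_F`, `β_Δ < α̲_F`, `r = NobleBetaF3.toArgs d B E (Γ 1)` is well formed with (H-Γ) at `n ≤ 1`, `I_{1,4}(0) ≤ V`, `b_k ≥ 0`, the two SHELL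
inequalities `4 S ≤ b₀` and `4 S + (2d/(2d−1)) (Γ 0) · b₂ ≤ b₁` hold (`S = 2 (Γ₀/(2d−1))² + (2dΓ₀/(2d−1))⁴ ((2d−2)/(2d−1) Γ₁') V` with `Γ₀ = Γ 0`,
`Γ₁' = Γ 1` the printed `Γ₁`, `Γ₂`), the table-majorant cells
`(0,0)`, `(1,0)` hold on `Q = {‖x‖₁ ≥ 3}` and the cells `(1,1)`, `(1,2)`, `(1,3)` on `𝒳`, `(1,6)` at `0`, at `srwTrueAlt d B.αFlow E.αFup`, then
`NobleImprovementInputsAt d cμ c Γ B b`.  On the window `(2d−1)p ≤ f₁(p) ≤ Γ₁ = Γ 0` and `f₂(p) ≤ Γ₂ = Γ 1`, so `τ_p ≤ S` on the shell (§2)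
and `2dp ≤ (2d/(2d−1)) Γ₁`.
[cite: FitznerVanDerHofstad2017, Prop. 2.1–2.2, (2.19), (2.21)–(2.23), §2.5; §4.2 (4.18); notebook Percolation.nb `boundF3[2,o]`, `boundF3[3,o]`]
[cite: FitznerVanDerHofstad2016NoBLE, §3.3.5 (3.87) p. 1079; Assumption 2.7 and Prop. 4.5 (pp. 1059–1060, 1088); §5.3.2 p. 1097] -/
theorem nobleImprovementInputsAt_of_simplifiedFormF3_srwTrueAlt_smallX (hd : 9 ≤ d) {cμ : ℝ} {c : Fin 6 → ℝ} {Γ : Fin 3 → ℝ}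
    {B : NobleBeta} {E : NobleBetaF3}
    (hF3 : ∀ p : unitInterval, p ∈ Set.Ioo (nbwThresholdI d) (criticalProbI d) →
      (∀ i, Literature.Barriers.CriticalPhenomena.nobleF d cμ c i p ≤ Γ i) → NobleSimplifiedFormF3At d p B E)
    (hα1 : 1 ≤ B.αFlow) (hgap : B.βΔ < B.αFlow) (hr : (NobleBetaF3.toArgs d B E (Γ 1)).WF)
    (hΓ : ∀ n ≤ 1, (NobleBetaF3.toArgs d B E (Γ 1)).Gamma2dash ^ n * (NobleBetaF3.toArgs d B E (Γ 1)).bRp ≤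
      (NobleBetaF3.toArgs d B E (Γ 1)).bRpDelta)
    {V : ℝ} (hV : srwI d 1 4 0 ≤ V) {b : Fin 6 → ℝ} (hb : ∀ k, 0 ≤ b k)
    (hS0 : 4 * (2 * (Γ 0 / (2 * d - 1)) ^ 2 + (2 * d / (2 * d - 1) * Γ 0) ^ 4 * ((2 * d - 2) / (2 * d - 1) * Γ 1) * V) ≤ b 0)
    (hS1 : 4 * (2 * (Γ 0 / (2 * d - 1)) ^ 2 + (2 * d / (2 * d - 1) * Γ 0) ^ 4 * ((2 * d - 2) / (2 * d - 1) * Γ 1) * V) +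
      2 * d / (2 * d - 1) * Γ 0 * b 2 ≤ b 1)
    (h0Q : ∀ x : Site d, 3 ≤ ∑ j, |x j| → boundHD75 (srwTrueAlt d B.αFlow E.αFup) 0 0 x (NobleBetaF3.toArgs d B E (Γ 1)) ≤ b 0)
    (h1Q : ∀ x : Site d, 3 ≤ ∑ j, |x j| → boundHD75 (srwTrueAlt d B.αFlow E.αFup) 1 0 x (NobleBetaF3.toArgs d B E (Γ 1)) ≤ b 1)
    (h2 : ∀ x ∈ calX d, boundHD75 (srwTrueAlt d B.αFlow E.αFup) 1 1 x (NobleBetaF3.toArgs d B E (Γ 1)) ≤ b 2)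
    (h3 : ∀ x ∈ calX d, boundHD75 (srwTrueAlt d B.αFlow E.αFup) 1 2 x (NobleBetaF3.toArgs d B E (Γ 1)) ≤ b 3)
    (h4 : ∀ x ∈ calX d, boundHD75 (srwTrueAlt d B.αFlow E.αFup) 1 3 x (NobleBetaF3.toArgs d B E (Γ 1)) ≤ b 4)
    (h5 : boundHD75 (srwTrueAlt d B.αFlow E.αFup) 1 6 0 (NobleBetaF3.toArgs d B E (Γ 1)) ≤ b 5) :
    NobleImprovementInputsAt d cμ c Γ B b := by
  intro p hp hf
  have hF := hF3 p hp hf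
  have hpc : (p : ℝ) < criticalProb (zdGraph d) (0 : Site d) := by
    rw [← coe_criticalProbI]
    exact Subtype.coe_lt_coe.2 hp.2
  have hΓ1 : (2 * d - 1) * (p : ℝ) ≤ Γ 0 := (two_d_sub_one_mul_le_nobleF1 cμ p).trans (by simpa only [nobleF_zero] using hf 0)
  have hΓ2 : nobleF2 d p ≤ Γ 1 := by simpa only [nobleF_one] using hf 1
  have hτ : ∀ x : Site d, ∑ j, |x j| = 2 →
      tau d p 0 x ≤ 2 * (Γ 0 / (2 * d - 1)) ^ 2 + (2 * d / (2 * d - 1) * Γ 0) ^ 4 * ((2 * d - 2) / (2 * d - 1) * Γ 1) * V :=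
    fun x hx => tau_le_smallX_of_srwI_le (by omega) p hp.2 hΓ1 hΓ2 hV hx
  have h2dp : 2 * d * (p : ℝ) * b 2 ≤ 2 * d / (2 * d - 1) * Γ 0 * b 2 :=
    mul_le_mul_of_nonneg_right (two_d_mul_le_of_le (by omega) p hΓ1) (hb 2)
  exact ⟨hF.toSimplifiedFormAt, nobleWeightedDiagramBoundAt_of_simplifiedFormF3_srwTrueAlt_smallX hd hpc hF hΓ2 hα1 hgap hr hΓ hb
    (fun x hx => by linarith [hτ x hx]) (fun x hx => by linarith [hτ x hx]) h0Q h1Q h2 h3 h4 h5⟩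

end Literature.Probability.FitznerVanDerHofstad2017

end
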